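import Summits.QuantumFields.YangMills.Theorems.BalabanUVNodesN19MGFKernelTower

/-!
# Route `BalabanUVNodes`, node N19 (NE7), lens ROW MF-ID — THE KERNEL REPRESENTATION OF NODE 00's SLOT RECURSION AT THE IDENTITY SELECTOR (module A, part 2):
# every slot of def-T's tower `texpAOfRecordFrom … (g·b) w (rstepSlotOfRecord … ppSel)` started at a comparable dressing (`m ≤ g ≤ M`, `0 < m`) IS
# `toReal ∫⁻ ofReal∘g d(slotMeasure k s V)`; the class measures are FINITE (mass bound without `HaarAC`); every class weight `∫ χ_k(s)·slot_k(s)` is the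
# integral of the dressing against `classMeasureOfSlots` — for `g = e^{t·F}` a MOMENT GENERATING FUNCTION, t-free measure

Cell `pub-ymgap`, YM-PLAN Track A (HUMAN RULING D-0062), seat `pub-ymgap-dag-n19-d` (g6), lens decomp v5 ROW MF-ID, dag-lead REBALANCE №65 (c).  Filing
`--kind proof --supports stmt-QuantumFields-19912 --as helper` (K3‴ `SpineGivenEndpointR13`; count-neutral).  Part 1 = `…N19MGFKernelTower` (the measure-valued
recursion `slotMeasure`, its measurability ∕ pointwise finiteness, the identity-selector R-step lemmas, the disintegration inequality); the consumer is
`…N19MGFFormAtRecord` (F3's `dressedSlotsOfDatum₉` ∕ `classWeightOfDatum₉` at `ppSelIdOfRecord` and at the K0′ witness `θ₀`).  [III] = [Balaban1988Convergent],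
[IV] = [Balaban1989LargeFieldI].

WHAT IS PROVED (bookkeeping; junk conventions of def-T's Bochner step MATCHED — `toReal ∞ = 0` —, so NO integrability hypothesis appears).
* §4 `tstepOfRecord_eq_toReal_lintegral_preSlotMeasure` (def-T's T-step (†) of a family `toReal ∫⁻ g dQ` is `toReal ∫⁻ g d(preSlotMeasure Q)`); ★
  `texpAOfRecordFrom_eq_toReal_lintegral_slotMeasure` — THE representation, by induction on the level: def-T's T-step by §4's lemma, def-R's identity-selector
  R-step by part 1's three cases against the reference pre-slot `refPreSlot` (sandwich `m·ref ≤ actual ≤ M·ref`, via dag-n19-e's generic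
  `…KernelChainRStep.rstepOfSel_id_TexpA_of_slot_sandwich'`).
* §5 `lintegral_slotMeasure_univ_le` (mass ≤ `∫ ofReal b`, part 1's disintegration INEQUALITY — no `HaarAC`, no `k < p.K`), `isFiniteMeasure_classMeasureOfSlots`,
  `lintegral_classMeasureOfSlots`, `integral_chi_mul_texpAOfRecordFrom_eq` (class weight = `toReal ∫⁻ ofReal∘g dν`), ★ `integral_chi_mul_texpAOfRecordFrom_eq_mgf`
  (start `e^{t·F}·b`, `|F| ≤ B`: class weight `= mgf F (classMeasureOfSlots …) t`).

HONEST FRAMING — what this is NOT.  [folklore ∕ bookkeeping] (Mathlib `Measure.bind` ∕ `withDensity` ∕ `lintegral`, b01 `fibreIntegral`); identity selector only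
(lens v5 M19: not at a contentful selector); displayed laws `0 ≤ w ≤ 1`, joint measurability of `w`, measurable `χ_k` (NODE 00's (H-U) ∕ (H-ζ) rows);
nothing of Bałaban's asserted or instantiated; NE7 ∕ NE1′ NOT proved; N19 NOT discharged (0∕1); K3‴ NOT claimed; counts UNMOVED.  One finite four-torus
programme at fixed `ε` — NOT ℝ⁴, NOT infinite volume, NOT OS, NOT a mass gap, NOT the Clay problem.  No `sorry`, no `axiom`, no `instance`, no `notation`.
-/

noncomputable section

namespace Summit.QuantumFields.YangMills.BalabanUVNodes.N19MGFKernelTower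

open MeasureTheory ProbabilityTheory
open scoped ENNReal
open Literature.MathematicalPhysics.QuantumFieldTheory.Balaban1983to89
open Literature.MathematicalPhysics.QuantumFieldTheory.Balaban1983to89.Node00
open Literature.MathematicalPhysics.QuantumFieldTheory.Balaban1983to89.T4DressedR (exp_dressing_bounds)
open T4Continuum T4TermReprCoupling B14.Eq218Concrete
open T4AveragingDisintegration hiding SU
open B15.BasicStep (fibreIntegral)

/-! ## §4 THE KERNEL REPRESENTATION: every slot of the tower started at a comparable dressing `g·b` is `toReal ∫⁻ g d(slotMeasure)` -/

section Representation

variable {F : T4Family} {N : ℕ} [NeZero N] {ν : Stage7Numerics} {τ : TowerNumerics}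
variable {w : StepWeightsOfRecord F N ν τ.M} {p : B12.RunParams} {g : ℕ → ℝ}

/-- **def-T's T-STEP (†) IS `toReal ∫⁻ g d(pre-𝐑 measure)`** on any slot family of the form `T(s)(U) = toReal ∫⁻ g d Q(s)(U)` with `Q` measurable,
pointwise finite and `g ≤ M < ∞` measurable (step weights `0 ≤ w` jointly measurable, `χ_k` measurable) — Bochner ↔ lintegral with MATCHING junk values
(`toReal ∞ = 0` is def-T's value where its integrand is not integrable). [cite: Balaban1988Convergent, (3.1) p.264, (3.25) p.270 (bookkeeping)] -/
theorem tstepOfRecord_eq_toReal_lintegral_preSlotMeasure {k : ℕ} (hw0 : ∀ s' U V', 0 ≤ w p g k s' U V')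
    (hwm : ∀ s', Measurable fun z : GaugeField (F.P p.K) (k + 1) (SU N) × GaugeField (F.P p.K) k (SU N) => w p g k s' z.2 z.1)
    (hχm : ∀ s, Measurable (chiSeqOfRecord F N ν τ.M g p.K k s))
    {Q : SeqOfRecord F ν τ.M g p.K k → GaugeField (F.P p.K) k (SU N) → Measure (GaugeField (F.P p.K) 0 (SU N))}
    (hQ : ∀ s, Measurable (Q s)) (hQfin : ∀ s U, Q s U Set.univ < ∞)
    {gd : GaugeField (F.P p.K) 0 (SU N) → ℝ≥0∞} (hgm : Measurable gd) {M : ℝ≥0∞} (hM : M ≠ ∞) (hgM : ∀ x, gd x ≤ M)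
    {T : TexpASlot F N ν τ.M p g k} (hT : ∀ s U, T s U = (∫⁻ x, gd x ∂(Q s U)).toReal)
    (s' : SeqOfRecord F ν τ.M g p.K (k + 1)) (V' : GaugeField (F.P p.K) (k + 1) (SU N)) :
    tstepOfRecord F N ν τ.M w p g k T s' V' = (∫⁻ x, gd x ∂(preSlotMeasure F N ν τ w p g k Q s' V')).toReal := by
  have hGfin : ∀ s U, ∫⁻ x, gd x ∂(Q s U) < ∞ := fun s U =>
    (lintegral_mono fun x => hgM x).trans_lt (by rw [lintegral_const]; exact ENNReal.mul_lt_top hM.lt_top (hQfin s U))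
  have hGm : ∀ s, Measurable fun U => ∫⁻ x, gd x ∂(Q s U) := fun s => (Measure.measurable_lintegral hgm).comp (hQ s)
  have hTf : ∀ s, T s = fun U => (∫⁻ x, gd x ∂(Q s U)).toReal := fun s => funext (hT s)
  have hχ0 := chiSeqOfRecord_nonneg F N ν τ.M g p.K k s'.init
  have hφ0 : ∀ U, 0 ≤ w p g k s' U V' * (chiSeqOfRecord F N ν τ.M g p.K k s'.init U * T s'.init U) := fun U =>
    mul_nonneg (hw0 s' U V') (mul_nonneg (hχ0 U) (by rw [hT]; exact ENNReal.toReal_nonneg))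
  have hφm : Measurable fun U => w p g k s' U V' * (chiSeqOfRecord F N ν τ.M g p.K k s'.init U * T s'.init U) := by
    rw [hTf]
    exact ((hwm s').comp measurable_prodMk_left).mul ((hχm _).mul (hGm _).ennreal_toReal)
  have hφe : ∀ U, ENNReal.ofReal (w p g k s' U V' * (chiSeqOfRecord F N ν τ.M g p.K k s'.init U * T s'.init U))
      = ENNReal.ofReal (w p g k s' U V' * chiSeqOfRecord F N ν τ.M g p.K k s'.init U) * ∫⁻ x, gd x ∂(Q s'.init U) := by
    intro U
    rw [← mul_assoc, ENNReal.ofReal_mul (mul_nonneg (hw0 s' U V') (hχ0 U)), hT, ENNReal.ofReal_toReal (hGfin _ _).ne]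
  rw [tstepOfRecord_apply, transportOfRecord]
  show (avgDensity (avOfRecord F N p.K k).avg V' : ℝ) *
      ∫ U, w p g k s' U V' * (chiSeqOfRecord F N ν τ.M g p.K k s'.init U * T s'.init U) ∂(avgKernel (avOfRecord F N p.K k).avg V') = _
  rw [integral_eq_lintegral_of_nonneg_ae (ae_of_all _ hφ0) hφm.aestronglyMeasurable, lintegral_congr hφe,
    lintegral_preSlotMeasure hwm hχm hQ s' V' hgm, ENNReal.toReal_mul, ENNReal.coe_toReal]

/-- **THE KERNEL REPRESENTATION OF THE SLOT RECURSION AT THE IDENTITY SELECTOR.**  Run def-T's start-generic tower from the start `g·b` (reference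
start `b ≥ 0` measurable; dressing `g` measurable with `m ≤ g ≤ M`, `0 < m`) with step weights `0 ≤ w` (jointly measurable), measurable `χ_k`, and
def-R's R-slot operation at a selector that is the IDENTITY at every positive level.  Then EVERY slot is the integral of the dressing against the
t-free slot measure: `slot_k(s)(V) = toReal ∫⁻ ofReal∘g d(slotMeasure k s V)` — induction on the level through §4's T-step lemma and §2a's three
identity-R-step cases (reference family = the `g ≡ 1` mass `refPreSlot`, sandwiched `m·ref ≤ actual ≤ M·ref`).  THE piece the MGF road needs:
positive-LINEARITY of the whole lineage in the dressing. [cite: Balaban1988Convergent, (2.18) p.257, (3.24)–(3.25) p.270; Balaban1989LargeFieldI, (0.3) p.176 (bookkeeping)] -/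
theorem texpAOfRecordFrom_eq_toReal_lintegral_slotMeasure {ppSel : PpSelOfRecord F ν τ.M}
    (hsel : ∀ (k : ℕ) (s : SeqOfRecord F ν τ.M g p.K (k + 1)), ppSel p g (k + 1) s = s)
    (hw0 : ∀ k s' U V', 0 ≤ w p g k s' U V')
    (hwm : ∀ k s', Measurable fun z : GaugeField (F.P p.K) (k + 1) (SU N) × GaugeField (F.P p.K) k (SU N) => w p g k s' z.2 z.1)
    (hχm : ∀ k s, Measurable (chiSeqOfRecord F N ν τ.M g p.K k s))
    {b : GaugeField (F.P p.K) 0 (SU N) → ℝ} (hbm : Measurable b) (hb0 : ∀ U, 0 ≤ b U)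
    {gd : GaugeField (F.P p.K) 0 (SU N) → ℝ} (hgm : Measurable gd) {m M : ℝ} (hm : 0 < m) (hM0 : 0 ≤ M)
    (hlo : ∀ U, m ≤ gd U) (hhi : ∀ U, gd U ≤ M)
    {start : (p : B12.RunParams) → (ℕ → ℝ) → Density (F.P p.K) 0 (SU N)} (hstart : ∀ U, start p g U = gd U * b U) :
    ∀ (k : ℕ) (s : SeqOfRecord F ν τ.M g p.K k) (V : GaugeField (F.P p.K) k (SU N)),
      texpAOfRecordFrom F N ν τ.M start w (rstepSlotOfRecord F N ν τ ppSel) p g k s V =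
        (∫⁻ x, ENNReal.ofReal (gd x) ∂(slotMeasure F N ν τ w p g b k s V)).toReal
  | 0, s, U => by
      rw [texpAOfRecordFrom_zero, hstart, slotMeasure_zero, lintegral_smul_measure, lintegral_dirac' _ hgm.ennreal_ofReal,
        smul_eq_mul, ENNReal.toReal_mul, ENNReal.toReal_ofReal (hb0 U), ENNReal.toReal_ofReal (hm.le.trans (hlo U)), mul_comm]
  | k + 1, s', V' => by
      -- the level-k representation (induction hypothesis) and the level-k data
      have ih : ∀ (s : SeqOfRecord F ν τ.M g p.K k) (U : GaugeField (F.P p.K) k (SU N)),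
          texpAOfRecordFrom F N ν τ.M start w (rstepSlotOfRecord F N ν τ ppSel) p g k s U =
            (∫⁻ x, ENNReal.ofReal (gd x) ∂(slotMeasure F N ν τ w p g b k s U)).toReal := fun s U =>
        texpAOfRecordFrom_eq_toReal_lintegral_slotMeasure hsel hw0 hwm hχm hbm hb0 hgm hm hM0 hlo hhi hstart k s U
      have hQm : ∀ s, Measurable (slotMeasure F N ν τ w p g b k s) := measurable_slotMeasure hwm hχm hbm k
      have hQfin := slotMeasure_univ_lt_top (w := w) (g := g) b k
      have hgM : ∀ x, ENNReal.ofReal (gd x) ≤ ENNReal.ofReal M := fun x => ENNReal.ofReal_le_ofReal (hhi x)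
      -- the pre-𝐑 slots of level k+1 ARE `toReal ∫⁻ g d(pre-𝐑 measure)`, for EVERY sequence and coarse field (§4's T-step lemma on the IH)
      have hPs : ∀ (s : SeqOfRecord F ν τ.M g p.K (k + 1)) W,
          tstepOfRecord F N ν τ.M w p g k (texpAOfRecordFrom F N ν τ.M start w (rstepSlotOfRecord F N ν τ ppSel) p g k) s W
            = (∫⁻ x, ENNReal.ofReal (gd x) ∂(preSlotMeasure F N ν τ w p g k (slotMeasure F N ν τ w p g b k) s W)).toReal := fun s W =>
        tstepOfRecord_eq_toReal_lintegral_preSlotMeasure (hw0 k) (hwm k) (hχm k) hQm hQfin hgm.ennreal_ofReal ENNReal.ofReal_ne_top hgM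
          ih s W
      -- the two-sided sandwich against the reference pre-𝐑 slot (total mass), in `ℝ≥0∞` and in `ℝ`
      have hΛlo : ∀ (s : SeqOfRecord F ν τ.M g p.K (k + 1)) W,
          ENNReal.ofReal m * preSlotMeasure F N ν τ w p g k (slotMeasure F N ν τ w p g b k) s W Set.univ
            ≤ ∫⁻ x, ENNReal.ofReal (gd x) ∂(preSlotMeasure F N ν τ w p g k (slotMeasure F N ν τ w p g b k) s W) := fun s W => by
        rw [← lintegral_const]
        exact lintegral_mono fun x => ENNReal.ofReal_le_ofReal (hlo x)
      have hΛhi : ∀ (s : SeqOfRecord F ν τ.M g p.K (k + 1)) W,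
          ∫⁻ x, ENNReal.ofReal (gd x) ∂(preSlotMeasure F N ν τ w p g k (slotMeasure F N ν τ w p g b k) s W)
            ≤ ENNReal.ofReal M * preSlotMeasure F N ν τ w p g k (slotMeasure F N ν τ w p g b k) s W Set.univ := fun s W => by
        rw [← lintegral_const]
        exact lintegral_mono fun x => hgM x
      have hm0 : ENNReal.ofReal m ≠ 0 := (ENNReal.ofReal_pos.2 hm).ne'
      have hPtop : ∀ W, preSlotMeasure F N ν τ w p g k (slotMeasure F N ν τ w p g b k) s' W Set.univ = ∞ →
          tstepOfRecord F N ν τ.M w p g k (texpAOfRecordFrom F N ν τ.M start w (rstepSlotOfRecord F N ν τ ppSel) p g k) s' W = 0 := by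
        intro W htop
        have hinf : ∫⁻ x, ENNReal.ofReal (gd x) ∂(preSlotMeasure F N ν τ w p g k (slotMeasure F N ν τ w p g b k) s' W) = ∞ := by
          refine top_unique ?_
          calc (⊤ : ℝ≥0∞) = ENNReal.ofReal m * ∞ := (ENNReal.mul_top hm0).symm
            _ ≤ _ := htop ▸ hΛlo s' W
        rw [hPs s' W, hinf, ENNReal.toReal_top]
      have hsand : ∀ (s : SeqOfRecord F ν τ.M g p.K (k + 1)) W,
          m * refPreSlot F N ν τ p g k (preSlotMeasure F N ν τ w p g k (slotMeasure F N ν τ w p g b k)) s W ≤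
              tstepOfRecord F N ν τ.M w p g k (texpAOfRecordFrom F N ν τ.M start w (rstepSlotOfRecord F N ν τ ppSel) p g k) s W ∧
            tstepOfRecord F N ν τ.M w p g k (texpAOfRecordFrom F N ν τ.M start w (rstepSlotOfRecord F N ν τ ppSel) p g k) s W ≤
              M * refPreSlot F N ν τ p g k (preSlotMeasure F N ν τ w p g k (slotMeasure F N ν τ w p g b k)) s W := by
        intro s W
        rw [hPs s W]
        unfold refPreSlot
        by_cases htop : preSlotMeasure F N ν τ w p g k (slotMeasure F N ν τ w p g b k) s W Set.univ = ∞
        · have hinf : ∫⁻ x, ENNReal.ofReal (gd x) ∂(preSlotMeasure F N ν τ w p g k (slotMeasure F N ν τ w p g b k) s W) = ∞ := by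
            refine top_unique ?_
            calc (⊤ : ℝ≥0∞) = ENNReal.ofReal m * ∞ := (ENNReal.mul_top hm0).symm
              _ ≤ _ := htop ▸ hΛlo s W
          rw [hinf, htop, ENNReal.toReal_top, mul_zero, mul_zero]
          exact ⟨le_rfl, le_rfl⟩
        · constructor
          · have h1 := ENNReal.toReal_mono ((hΛhi s W).trans_lt (ENNReal.mul_lt_top ENNReal.ofReal_lt_top
              (lt_top_iff_ne_top.2 htop))).ne (hΛlo s W)
            rwa [ENNReal.toReal_mul, ENNReal.toReal_ofReal hm.le] at h1
          · have h2 := ENNReal.toReal_mono (ENNReal.mul_ne_top ENNReal.ofReal_ne_top htop) (hΛhi s W)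
            rwa [ENNReal.toReal_mul, ENNReal.toReal_ofReal hM0] at h2
      -- the R-step at the identity selector: three cases
      rw [texpAOfRecordFrom_succ, slotMeasure_succ, lintegral_smul_measure, smul_eq_mul]
      have hid : ppSel p g (k + 1) = id := funext (hsel k)
      show rstepSlot F N ν τ p g (k + 1) (ppSel p g (k + 1)) _ s' V' = _
      rw [hid]
      unfold liveFactor
      split_ifs with hc
      · rw [one_mul, rstepSlot_id_eq_self_of_ref_ne_zero p g (k + 1) hm hM0 (fun s W => (hsand s W).1) (fun s W => (hsand s W).2)
          s' V' hc.2, hPs s' V']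
      · rw [zero_mul, ENNReal.toReal_zero]
        by_cases htop : preSlotMeasure F N ν τ w p g k (slotMeasure F N ν τ w p g b k) s' V' Set.univ < ∞
        · have hR0 : rstepSlot F N ν τ p g (k + 1) id
              (refPreSlot F N ν τ p g k (preSlotMeasure F N ν τ w p g k (slotMeasure F N ν τ w p g b k))) s' V' = 0 := by
            by_contra h
            exact hc ⟨htop, h⟩
          by_cases h00 : refPreSlot F N ν τ p g k (preSlotMeasure F N ν τ w p g k (slotMeasure F N ν τ w p g b k)) s' V' = 0
          · refine rstepSlot_id_eq_zero_of_eq_zero p g (k + 1) _ s' V' (le_antisymm ?_ ?_)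
            · have h := (hsand s' V').2
              rw [h00, mul_zero] at h
              exact h
            · have h := (hsand s' V').1
              rw [h00, mul_zero] at h
              exact h
          · exact rstepSlot_id_eq_zero_of_ref p g (k + 1) hm hM0 (fun s W => (hsand s W).1) (fun s W => (hsand s W).2) s' V' hR0 h00
        · exact rstepSlot_id_eq_zero_of_eq_zero p g (k + 1) _ s' V' (hPtop V' (top_le_iff.1 (not_lt.1 htop)))

end Representation

/-! ## §5 Mass bound (no `HaarAC`), the FINITE class measures, and the class weight as an integral of the dressing ∕ an MGF -/

section ClassMeasure

variable {F : T4Family} {N : ℕ} [NeZero N] {ν : Stage7Numerics} {τ : TowerNumerics}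
variable {w : StepWeightsOfRecord F N ν τ.M} {p : B12.RunParams} {g : ℕ → ℝ}

/-- **THE MASS BOUND**: `∫ slotMeasure_k(s)(V)(X₀) dV_k ≤ ∫ ofReal(b) dU₀` at EVERY level — the live factor and `ofReal(w·χ_k) ≤ 1` only lose mass,
and def-T's transport never creates any (§1's disintegration INEQUALITY: no `HaarAC`, no `k < p.K`). [cite: Balaban1988Convergent, (3.1) p.264; Balaban1987RG1, (0.4) p.253 (bookkeeping)] -/
theorem lintegral_slotMeasure_univ_le (hw1 : ∀ k s' U V', w p g k s' U V' ≤ 1)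
    (hwm : ∀ k s', Measurable fun z : GaugeField (F.P p.K) (k + 1) (SU N) × GaugeField (F.P p.K) k (SU N) => w p g k s' z.2 z.1)
    (hχm : ∀ k s, Measurable (chiSeqOfRecord F N ν τ.M g p.K k s)) {b : GaugeField (F.P p.K) 0 (SU N) → ℝ} (hbm : Measurable b) :
    ∀ (k : ℕ) (s : SeqOfRecord F ν τ.M g p.K k),
      ∫⁻ V, slotMeasure F N ν τ w p g b k s V Set.univ ∂(fieldMeasure (F.P p.K) k (SU N)) ≤
        ∫⁻ U, ENNReal.ofReal (b U) ∂(fieldMeasure (F.P p.K) 0 (SU N))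
  | 0, s => by
      refine le_of_eq (lintegral_congr fun U => ?_)
      rw [slotMeasure_zero, Measure.smul_apply, smul_eq_mul, Measure.dirac_apply_of_mem (Set.mem_univ _), mul_one]
  | k + 1, s' => by
      have ih := lintegral_slotMeasure_univ_le hw1 hwm hχm hbm k s'.init
      have hQm : ∀ s, Measurable (slotMeasure F N ν τ w p g b k s) := measurable_slotMeasure hwm hχm hbm k
      have hQu : ∀ s, Measurable fun U => slotMeasure F N ν τ w p g b k s U Set.univ := fun s =>
        (Measure.measurable_coe MeasurableSet.univ).comp (hQm s)
      have hd1 : ∀ U (V' : GaugeField (F.P p.K) (k + 1) (SU N)),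
          ENNReal.ofReal (w p g k s' U V' * chiSeqOfRecord F N ν τ.M g p.K k s'.init U) ≤ 1 := fun U V' =>
        ENNReal.ofReal_le_one.2 (mul_le_one₀ (hw1 k s' U V') (chiSeqOfRecord_nonneg F N ν τ.M g p.K k _ U)
          (chiSeqOfRecord_le_one F N ν τ.M g p.K k _ U))
      calc ∫⁻ V', slotMeasure F N ν τ w p g b (k + 1) s' V' Set.univ ∂(fieldMeasure (F.P p.K) (k + 1) (SU N))
          ≤ ∫⁻ V', preSlotMeasure F N ν τ w p g k (slotMeasure F N ν τ w p g b k) s' V' Set.univ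
              ∂(fieldMeasure (F.P p.K) (k + 1) (SU N)) := by
            refine lintegral_mono fun V' => ?_
            rw [slotMeasure_succ, Measure.smul_apply, smul_eq_mul]
            exact mul_le_of_le_one_left (zero_le) (liveFactor_le_one p g k _ s' V')
        _ = ∫⁻ V', (avgDensity (avOfRecord F N p.K k).avg V' : ℝ≥0∞) *
              ∫⁻ U, ENNReal.ofReal (w p g k s' U V' * chiSeqOfRecord F N ν τ.M g p.K k s'.init U) *
                slotMeasure F N ν τ w p g b k s'.init U Set.univ ∂(avgKernel (avOfRecord F N p.K k).avg V')
              ∂(fieldMeasure (F.P p.K) (k + 1) (SU N)) := by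
            refine lintegral_congr fun V' => ?_
            rw [← lintegral_one, lintegral_preSlotMeasure (hwm k) (hχm k) hQm s' V' measurable_const]
            simp only [lintegral_one]
        _ ≤ ∫⁻ V', (avgDensity (avOfRecord F N p.K k).avg V' : ℝ≥0∞) *
              ∫⁻ U, slotMeasure F N ν τ w p g b k s'.init U Set.univ ∂(avgKernel (avOfRecord F N p.K k).avg V')
              ∂(fieldMeasure (F.P p.K) (k + 1) (SU N)) := by
            refine lintegral_mono fun V' => mul_le_mul' le_rfl (lintegral_mono fun U => ?_)
            exact mul_le_of_le_one_left (zero_le) (hd1 U V')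
        _ ≤ ∫⁻ U, slotMeasure F N ν τ w p g b k s'.init U Set.univ ∂(fieldMeasure (F.P p.K) k (SU N)) :=
            lintegral_margDensity_mul_lintegral_condLaw_le _ _ (avOfRecord_measurable F N p.K k) (hQu _)
        _ ≤ _ := ih

/-- **THE CLASS MEASURES ARE FINITE** (reference start with `∫ ofReal(b) < ∞`, e.g. an integrable Boltzmann weight): the `finite` clause of
`DressedMGFForm.MGFForm`. [cite: Balaban1988Convergent, (2.18) p.257 (bookkeeping)] -/
theorem isFiniteMeasure_classMeasureOfSlots (hw1 : ∀ k s' U V', w p g k s' U V' ≤ 1)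
    (hwm : ∀ k s', Measurable fun z : GaugeField (F.P p.K) (k + 1) (SU N) × GaugeField (F.P p.K) k (SU N) => w p g k s' z.2 z.1)
    (hχm : ∀ k s, Measurable (chiSeqOfRecord F N ν τ.M g p.K k s)) {b : GaugeField (F.P p.K) 0 (SU N) → ℝ} (hbm : Measurable b)
    (hbfin : ∫⁻ U, ENNReal.ofReal (b U) ∂(fieldMeasure (F.P p.K) 0 (SU N)) < ∞) (k : ℕ) (s : SeqOfRecord F ν τ.M g p.K k) :
    IsFiniteMeasure (classMeasureOfSlots F N ν τ w p g b k s) := by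
  have hQm : Measurable (slotMeasure F N ν τ w p g b k s) := measurable_slotMeasure hwm hχm hbm k s
  have hQu : Measurable fun V => slotMeasure F N ν τ w p g b k s V Set.univ := (Measure.measurable_coe MeasurableSet.univ).comp hQm
  refine ⟨?_⟩
  unfold classMeasureOfSlots
  rw [Measure.bind_apply MeasurableSet.univ hQm.aemeasurable,
    lintegral_withDensity_eq_lintegral_mul _ (hχm k s).ennreal_ofReal hQu]
  calc ∫⁻ V, ((fun V => ENNReal.ofReal (chiSeqOfRecord F N ν τ.M g p.K k s V)) *
          fun V => slotMeasure F N ν τ w p g b k s V Set.univ) V ∂(fieldMeasure (F.P p.K) k (SU N))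
      ≤ ∫⁻ V, slotMeasure F N ν τ w p g b k s V Set.univ ∂(fieldMeasure (F.P p.K) k (SU N)) := by
        refine lintegral_mono fun V => ?_
        exact mul_le_of_le_one_left (zero_le) (ENNReal.ofReal_le_one.2 (chiSeqOfRecord_le_one F N ν τ.M g p.K k s V))
    _ ≤ ∫⁻ U, ENNReal.ofReal (b U) ∂(fieldMeasure (F.P p.K) 0 (SU N)) := lintegral_slotMeasure_univ_le hw1 hwm hχm hbm k s
    _ < ∞ := hbfin

/-- Integration against the class measure: `∫ f dν_k(s) = ∫ ofReal(χ_k(s)(V)) · (∫ f d slotMeasure_k(s)(V)) dV_k`.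
[cite: Balaban1988Convergent, (2.18) p.257 (bookkeeping)] -/
theorem lintegral_classMeasureOfSlots
    (hwm : ∀ k s', Measurable fun z : GaugeField (F.P p.K) (k + 1) (SU N) × GaugeField (F.P p.K) k (SU N) => w p g k s' z.2 z.1)
    (hχm : ∀ k s, Measurable (chiSeqOfRecord F N ν τ.M g p.K k s)) {b : GaugeField (F.P p.K) 0 (SU N) → ℝ} (hbm : Measurable b)
    (k : ℕ) (s : SeqOfRecord F ν τ.M g p.K k) {f : GaugeField (F.P p.K) 0 (SU N) → ℝ≥0∞} (hf : Measurable f) :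
    ∫⁻ x, f x ∂(classMeasureOfSlots F N ν τ w p g b k s) =
      ∫⁻ V, ENNReal.ofReal (chiSeqOfRecord F N ν τ.M g p.K k s V) * ∫⁻ x, f x ∂(slotMeasure F N ν τ w p g b k s V)
        ∂(fieldMeasure (F.P p.K) k (SU N)) := by
  have hQm : Measurable (slotMeasure F N ν τ w p g b k s) := measurable_slotMeasure hwm hχm hbm k s
  have hg : Measurable fun V => ∫⁻ x, f x ∂(slotMeasure F N ν τ w p g b k s V) := (Measure.measurable_lintegral hf).comp hQm
  unfold classMeasureOfSlots
  rw [Measure.lintegral_bind hQm.aemeasurable hf.aemeasurable,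
    lintegral_withDensity_eq_lintegral_mul _ (hχm k s).ennreal_ofReal hg]
  rfl

/-- **THE CLASS WEIGHT IS THE INTEGRAL OF THE DRESSING AGAINST THE CLASS MEASURE**: `∫ χ_k(s)·slot_k(s) dV_k = toReal ∫⁻ ofReal∘g dν_k(s)` for the
tower started at `g·b` (hypotheses of §4). [cite: Balaban1988Convergent, (2.18) p.257; King1986, (3.10) p.656 (bookkeeping)] -/
theorem integral_chi_mul_texpAOfRecordFrom_eq {ppSel : PpSelOfRecord F ν τ.M}
    (hsel : ∀ (k : ℕ) (s : SeqOfRecord F ν τ.M g p.K (k + 1)), ppSel p g (k + 1) s = s)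
    (hw0 : ∀ k s' U V', 0 ≤ w p g k s' U V')
    (hwm : ∀ k s', Measurable fun z : GaugeField (F.P p.K) (k + 1) (SU N) × GaugeField (F.P p.K) k (SU N) => w p g k s' z.2 z.1)
    (hχm : ∀ k s, Measurable (chiSeqOfRecord F N ν τ.M g p.K k s))
    {b : GaugeField (F.P p.K) 0 (SU N) → ℝ} (hbm : Measurable b) (hb0 : ∀ U, 0 ≤ b U)
    {gd : GaugeField (F.P p.K) 0 (SU N) → ℝ} (hgm : Measurable gd) {m M : ℝ} (hm : 0 < m) (hM0 : 0 ≤ M)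
    (hlo : ∀ U, m ≤ gd U) (hhi : ∀ U, gd U ≤ M)
    {start : (p : B12.RunParams) → (ℕ → ℝ) → Density (F.P p.K) 0 (SU N)} (hstart : ∀ U, start p g U = gd U * b U)
    (k : ℕ) (s : SeqOfRecord F ν τ.M g p.K k) :
    ∫ V, chiSeqOfRecord F N ν τ.M g p.K k s V * texpAOfRecordFrom F N ν τ.M start w (rstepSlotOfRecord F N ν τ ppSel) p g k s V
        ∂(fieldMeasure (F.P p.K) k (SU N)) =
      (∫⁻ x, ENNReal.ofReal (gd x) ∂(classMeasureOfSlots F N ν τ w p g b k s)).toReal := by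
  have hrep := texpAOfRecordFrom_eq_toReal_lintegral_slotMeasure hsel hw0 hwm hχm hbm hb0 hgm hm hM0 hlo hhi hstart k s
  have hQm : Measurable (slotMeasure F N ν τ w p g b k s) := measurable_slotMeasure hwm hχm hbm k s
  have hG : Measurable fun V => ∫⁻ x, ENNReal.ofReal (gd x) ∂(slotMeasure F N ν τ w p g b k s V) :=
    (Measure.measurable_lintegral hgm.ennreal_ofReal).comp hQm
  have hGfin : ∀ V, ∫⁻ x, ENNReal.ofReal (gd x) ∂(slotMeasure F N ν τ w p g b k s V) < ∞ := fun V =>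
    (lintegral_mono fun x => ENNReal.ofReal_le_ofReal (hhi x)).trans_lt
      (by rw [lintegral_const]; exact ENNReal.mul_lt_top ENNReal.ofReal_lt_top (slotMeasure_univ_lt_top b k s V))
  have hTf : texpAOfRecordFrom F N ν τ.M start w (rstepSlotOfRecord F N ν τ ppSel) p g k s =
      fun V => (∫⁻ x, ENNReal.ofReal (gd x) ∂(slotMeasure F N ν τ w p g b k s V)).toReal := funext (hrep)
  have hχ0 := chiSeqOfRecord_nonneg F N ν τ.M g p.K k s
  rw [hTf, integral_eq_lintegral_of_nonneg_ae (ae_of_all _ fun V => mul_nonneg (hχ0 V) ENNReal.toReal_nonneg)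
    (((hχm k s).mul hG.ennreal_toReal).aestronglyMeasurable), lintegral_classMeasureOfSlots hwm hχm hbm k s hgm.ennreal_ofReal]
  congr 1
  refine lintegral_congr fun V => ?_
  rw [ENNReal.ofReal_mul (hχ0 V), ENNReal.ofReal_toReal (hGfin V).ne]

/-- **THE CLASS WEIGHT OF THE EXPONENTIALLY DRESSED TOWER IS A MOMENT GENERATING FUNCTION**: for the start `e^{t·F}·b` (bounded measurable
observable `|F| ≤ B`, reference start `b ≥ 0` measurable), `∫ χ_k(s)·slot^t_k(s) dV_k = mgf F ν_k(s) t` with `ν_k(s) = classMeasureOfSlots`, t-FREE —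
the `repr` clause of `DressedMGFForm.MGFForm` at the identity selector. [cite: King1986, (3.10) p.656; Balaban1989LargeFieldI, (0.3) p.176 (bookkeeping)] -/
theorem integral_chi_mul_texpAOfRecordFrom_eq_mgf {ppSel : PpSelOfRecord F ν τ.M}
    (hsel : ∀ (k : ℕ) (s : SeqOfRecord F ν τ.M g p.K (k + 1)), ppSel p g (k + 1) s = s)
    (hw0 : ∀ k s' U V', 0 ≤ w p g k s' U V')
    (hwm : ∀ k s', Measurable fun z : GaugeField (F.P p.K) (k + 1) (SU N) × GaugeField (F.P p.K) k (SU N) => w p g k s' z.2 z.1)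
    (hχm : ∀ k s, Measurable (chiSeqOfRecord F N ν τ.M g p.K k s))
    {b : GaugeField (F.P p.K) 0 (SU N) → ℝ} (hbm : Measurable b) (hb0 : ∀ U, 0 ≤ b U)
    {Fo : GaugeField (F.P p.K) 0 (SU N) → ℝ} (hFm : Measurable Fo) {B : ℝ} (hFb : ∀ U, |Fo U| ≤ B) (t : ℝ)
    {start : (p : B12.RunParams) → (ℕ → ℝ) → Density (F.P p.K) 0 (SU N)} (hstart : ∀ U, start p g U = Real.exp (t * Fo U) * b U)
    (k : ℕ) (s : SeqOfRecord F ν τ.M g p.K k) :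
    ∫ V, chiSeqOfRecord F N ν τ.M g p.K k s V * texpAOfRecordFrom F N ν τ.M start w (rstepSlotOfRecord F N ν τ ppSel) p g k s V
        ∂(fieldMeasure (F.P p.K) k (SU N)) =
      ProbabilityTheory.mgf Fo (classMeasureOfSlots F N ν τ w p g b k s) t := by
  have hgm : Measurable fun U => Real.exp (t * Fo U) := Real.measurable_exp.comp (hFm.const_mul t)
  have h := integral_chi_mul_texpAOfRecordFrom_eq hsel hw0 hwm hχm hbm hb0 (gd := fun U => Real.exp (t * Fo U)) hgm
    (Real.exp_pos _) (Real.exp_pos _).le (fun U => (exp_dressing_bounds hFb t U).1) (fun U => (exp_dressing_bounds hFb t U).2) hstart k s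
  rw [h, ProbabilityTheory.mgf, integral_eq_lintegral_of_nonneg_ae (ae_of_all _ fun x => (Real.exp_pos _).le) hgm.aestronglyMeasurable]

end ClassMeasure

/-! ## §6 (v1.1) Every slot is MEASURABLE and every piece `χ_k(s)·slot_k(s)` INTEGRABLE (kernel representation + §5's finiteness): F3's displayed (e1)
integrability (`sum_classWeightOfDatum₉_eq_integral`'s `hint`) becomes a THEOREM at the identity selector (drawn by `…N19MGFFormAtRecord` v1.1). -/

section Integrability

variable {F : T4Family} {N : ℕ} [NeZero N] {ν : Stage7Numerics} {τ : TowerNumerics} {w : StepWeightsOfRecord F N ν τ.M} {p : B12.RunParams} {g : ℕ → ℝ}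

/-- **EVERY SLOT OF THE TOWER IS MEASURABLE** (identity selector; displayed laws; comparable start `g·b`): it is `toReal` of the integral of `ofReal∘g`
against the measurable kernel `slotMeasure k s` (§4). [cite: Balaban1988Convergent, (2.18) p.257 (bookkeeping)] -/
theorem measurable_texpAOfRecordFrom {ppSel : PpSelOfRecord F ν τ.M}
    (hsel : ∀ (k : ℕ) (s : SeqOfRecord F ν τ.M g p.K (k + 1)), ppSel p g (k + 1) s = s)
    (hw0 : ∀ k s' U V', 0 ≤ w p g k s' U V')
    (hwm : ∀ k s', Measurable fun z : GaugeField (F.P p.K) (k + 1) (SU N) × GaugeField (F.P p.K) k (SU N) => w p g k s' z.2 z.1)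
    (hχm : ∀ k s, Measurable (chiSeqOfRecord F N ν τ.M g p.K k s))
    {b : GaugeField (F.P p.K) 0 (SU N) → ℝ} (hbm : Measurable b) (hb0 : ∀ U, 0 ≤ b U)
    {gd : GaugeField (F.P p.K) 0 (SU N) → ℝ} (hgm : Measurable gd) {m M : ℝ} (hm : 0 < m) (hM0 : 0 ≤ M)
    (hlo : ∀ U, m ≤ gd U) (hhi : ∀ U, gd U ≤ M)
    {start : (p : B12.RunParams) → (ℕ → ℝ) → Density (F.P p.K) 0 (SU N)} (hstart : ∀ U, start p g U = gd U * b U)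
    (k : ℕ) (s : SeqOfRecord F ν τ.M g p.K k) :
    Measurable (texpAOfRecordFrom F N ν τ.M start w (rstepSlotOfRecord F N ν τ ppSel) p g k s) := by
  have hTf : texpAOfRecordFrom F N ν τ.M start w (rstepSlotOfRecord F N ν τ ppSel) p g k s =
      fun V => (∫⁻ x, ENNReal.ofReal (gd x) ∂(slotMeasure F N ν τ w p g b k s V)).toReal :=
    funext (texpAOfRecordFrom_eq_toReal_lintegral_slotMeasure hsel hw0 hwm hχm hbm hb0 hgm hm hM0 hlo hhi hstart k s)
  rw [hTf]
  exact ((Measure.measurable_lintegral hgm.ennreal_ofReal).comp (measurable_slotMeasure hwm hχm hbm k s)).ennreal_toReal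

/-- **EVERY PIECE `χ_k(s)·slot_k(s)` IS INTEGRABLE** over the level-`k` field measure (identity selector; displayed laws incl. `w ≤ 1`; reference start with
`∫ ofReal(b) < ∞`): its `lintegral` is `∫⁻ ofReal∘g dν_k(s) ≤ ofReal M · ν_k(s)(X₀) < ∞` by §5's finiteness — F3's displayed (e1) integrability, as a
theorem. [cite: Balaban1988Convergent, (2.18) p.257; King1986, (3.10) p.656 (bookkeeping)] -/
theorem integrable_chi_mul_texpAOfRecordFrom {ppSel : PpSelOfRecord F ν τ.M}
    (hsel : ∀ (k : ℕ) (s : SeqOfRecord F ν τ.M g p.K (k + 1)), ppSel p g (k + 1) s = s)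
    (hw0 : ∀ k s' U V', 0 ≤ w p g k s' U V') (hw1 : ∀ k s' U V', w p g k s' U V' ≤ 1)
    (hwm : ∀ k s', Measurable fun z : GaugeField (F.P p.K) (k + 1) (SU N) × GaugeField (F.P p.K) k (SU N) => w p g k s' z.2 z.1)
    (hχm : ∀ k s, Measurable (chiSeqOfRecord F N ν τ.M g p.K k s))
    {b : GaugeField (F.P p.K) 0 (SU N) → ℝ} (hbm : Measurable b) (hb0 : ∀ U, 0 ≤ b U)
    (hbfin : ∫⁻ U, ENNReal.ofReal (b U) ∂(fieldMeasure (F.P p.K) 0 (SU N)) < ∞)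
    {gd : GaugeField (F.P p.K) 0 (SU N) → ℝ} (hgm : Measurable gd) {m M : ℝ} (hm : 0 < m) (hM0 : 0 ≤ M)
    (hlo : ∀ U, m ≤ gd U) (hhi : ∀ U, gd U ≤ M)
    {start : (p : B12.RunParams) → (ℕ → ℝ) → Density (F.P p.K) 0 (SU N)} (hstart : ∀ U, start p g U = gd U * b U)
    (k : ℕ) (s : SeqOfRecord F ν τ.M g p.K k) :
    Integrable (fun V => chiSeqOfRecord F N ν τ.M g p.K k s V *
        texpAOfRecordFrom F N ν τ.M start w (rstepSlotOfRecord F N ν τ ppSel) p g k s V) (fieldMeasure (F.P p.K) k (SU N)) := by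
  have hrep := texpAOfRecordFrom_eq_toReal_lintegral_slotMeasure hsel hw0 hwm hχm hbm hb0 hgm hm hM0 hlo hhi hstart k s
  have hQm : Measurable (slotMeasure F N ν τ w p g b k s) := measurable_slotMeasure hwm hχm hbm k s
  have hG : Measurable fun V => ∫⁻ x, ENNReal.ofReal (gd x) ∂(slotMeasure F N ν τ w p g b k s V) :=
    (Measure.measurable_lintegral hgm.ennreal_ofReal).comp hQm
  have hGfin : ∀ V, ∫⁻ x, ENNReal.ofReal (gd x) ∂(slotMeasure F N ν τ w p g b k s V) < ∞ := fun V =>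
    (lintegral_mono fun x => ENNReal.ofReal_le_ofReal (hhi x)).trans_lt
      (by rw [lintegral_const]; exact ENNReal.mul_lt_top ENNReal.ofReal_lt_top (slotMeasure_univ_lt_top b k s V))
  have hχ0 := chiSeqOfRecord_nonneg F N ν τ.M g p.K k s
  have hTf : texpAOfRecordFrom F N ν τ.M start w (rstepSlotOfRecord F N ν τ ppSel) p g k s =
      fun V => (∫⁻ x, ENNReal.ofReal (gd x) ∂(slotMeasure F N ν τ w p g b k s V)).toReal := funext hrep
  haveI := isFiniteMeasure_classMeasureOfSlots hw1 hwm hχm hbm hbfin k s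
  rw [hTf]
  refine ⟨((hχm k s).mul hG.ennreal_toReal).aestronglyMeasurable, ?_⟩
  rw [hasFiniteIntegral_iff_ofReal (ae_of_all _ fun V => mul_nonneg (hχ0 V) ENNReal.toReal_nonneg)]
  calc ∫⁻ V, ENNReal.ofReal (chiSeqOfRecord F N ν τ.M g p.K k s V *
          (∫⁻ x, ENNReal.ofReal (gd x) ∂(slotMeasure F N ν τ w p g b k s V)).toReal) ∂(fieldMeasure (F.P p.K) k (SU N))
      = ∫⁻ V, ENNReal.ofReal (chiSeqOfRecord F N ν τ.M g p.K k s V) *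
          ∫⁻ x, ENNReal.ofReal (gd x) ∂(slotMeasure F N ν τ w p g b k s V) ∂(fieldMeasure (F.P p.K) k (SU N)) := by
        refine lintegral_congr fun V => ?_
        rw [ENNReal.ofReal_mul (hχ0 V), ENNReal.ofReal_toReal (hGfin V).ne]
    _ = ∫⁻ x, ENNReal.ofReal (gd x) ∂(classMeasureOfSlots F N ν τ w p g b k s) :=
        (lintegral_classMeasureOfSlots hwm hχm hbm k s hgm.ennreal_ofReal).symm
    _ ≤ ∫⁻ _, ENNReal.ofReal M ∂(classMeasureOfSlots F N ν τ w p g b k s) := lintegral_mono fun x => ENNReal.ofReal_le_ofReal (hhi x)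
    _ < ∞ := by
        rw [lintegral_const]
        exact ENNReal.mul_lt_top ENNReal.ofReal_lt_top (measure_lt_top _ _)

end Integrability

end Summit.QuantumFields.YangMills.BalabanUVNodes.N19MGFKernelTower

end
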